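import Summits.QuantumFields.YangMills.Theorems.TwistedTraceScaling.Negative.ValleyConstProximity
import Summits.QuantumFields.YangMills.Theorems.LuscherReductionTwistedTraceScalingValleySkeleton
import HarnessLib

/-!
# Negative lemma R11 (crux `TwistedTraceScaling`, stmt-QuantumFields-20203): the exponent constraint `q > 4p` of lane A's C3 skeleton is NECESSARY —
# the typed geometry sub-target `ValleyGeomAt L (β^{−p}) (β^{−q})` is FALSE for every `0 < q ≤ 4p` (every `L ≥ 2`)

Standing disprover `ym-cdisprove-20203-1` (gen 10, second lemma), answering lane A's request (fleet INBOX 2026-08-27T23:11Z: «is `ValleyGeomAt L (β^{−p})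
(β^{−q})` false for `q ≤ 4p`?»).  `ValleyGeomAt L δ η` (`…TwistedTraceScalingValleySkeleton`, p583588) asks: `∃ c₀ > 0, ∀ ε > 0`, eventually in `β`,
every `U ∈ valleySet L (δ β) (η β)` has a gauge-toron `g·V_θ` with `‖D_U v − D_{g·V_θ} v‖ ≤ ε·δ(β)·‖v‖` for all `v` (and a twisted direction).  The C3
skeleton `coarseNoIntruderAt_of_bo_geom_pow` feeds it at `(δ, η) = (β^{−p}, β^{−q})` and lane A's exponent ledger requires `q > 4p` for its PROOF ROUTE
(Łojasiewicz-1/4 to FLAT).  This file shows the TARGET ITSELF is false without it: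
* ★ `valleyGeom_false`: for any scales `δ, η → 0` with `0 < δ β` and `δ β⁴ ≤ M·η β` FREQUENTLY (some `M > 0`), `¬ ValleyGeomAt L δ η` (`L ≥ 2`);
* ★ `valleyGeom_pow_false`: `0 < p`, `0 < q ≤ 4p` ⇒ `¬ ValleyGeomAt L (powScale p) (powScale q)` (`L ≥ 2`) — so `q > 4p` (strictly: `q = 4p` fails too)
  is necessary in `coarseNoIntruderAt_of_bo_geom_pow`, not an artefact of the route through (Ł) + (F).
MECHANISM.  The R10 family `U = twoLinkCfg a_{θ/L} b_{Ls/θ}` (`s = √(η/(4#P+1))`, `θ = max(2Lδ, L√s)`) lies in the valley set in every regime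
(`R10.twoLinkCfg_mem_valleySet`).  (i) A single-link test vector `v = e_{(x+î, j), b}` in `covCurl_apply` isolates the transport `adRot(U(x,i))·e_b` at the
plaquette `(x, (i,j))` (`covCurl_single`, needs `x + î ≠ x`, i.e. `L ≥ 2`), so the GEOM closeness forces `|adRot(U_e)_{ab} − adRot((g·V_θ)_e)_{ab}| ≤ εδ` on all
direction-0/1 links (`abs_adRot_sub_le_of_covCurl`).  (ii) `adRot` closeness lifts to `SU(2)` closeness UP TO SIGN: `Σ_{ab}(adRot P − adRot Q)²_{ab} =
8(1 − ⟨p,q⟩²)` (`sum_adRot_sub_sq_eq`, the character identity `χ_adj = χ²_{1/2} − 1`), whence `‖P − Q‖_F ≤ 3εδ` or `‖P + Q‖_F ≤ 3εδ`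
(`frobNorm_sub_le_or_of_adRot`).  (iii) Signs are central, so the signed Polyakov loops of `g·V_θ` at a site are `±g(0)·diag^L·g(0)⁻¹` and COMMUTE; telescoping
(`exists_sign_lineHolonomy_sub_le`) puts them within `3Lεδ` of `a^L = rot(θ | i)`, `b^L = rot(L²s/θ | j)`, and R10's `min_le_of_commute_near_axes` gives
`sin(L²s/θ) ≤ 6Lεδ` (`min_sin_le_of_near_toron`).  (iv) When `δ⁴ ≤ Mη` one has `L²s/θ ≥ Lδ/(3√(M(4#P+1)) + 1)`, so Jordan's inequality contradicts the bound at
`ε = 1/(20(3√(M(4#P+1)) + 1))` — a FIXED `ε`, while GEOM claims every `ε > 0`.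
READING for lane A (COARSE-DESIGN §15–§16).  At `q > 4p` the same family is at `D`-distance `≍ s/δ = o(δ)` from the torons `V_{(θ/L,0,0)}` — consistent with
GEOM; at `q ≤ 4p` it is at distance `≍ η^{1/4} ≳ δ` from EVERY gauge-toron.  So the ledger line `q > 4p` is a property of the sub-target, and any
re-lining that wants a smaller `q/p` must change the GEOM text (e.g. closeness `ε·δ` ↦ `ε·max(δ, η^{1/4})`, which the ZPE-Lipschitz step then has to absorb).
HONEST FRAMING: fixed-lattice `SU(2)` geometry about a typed sub-target of a stub (S-BASE C3) of a child of the CONDITIONAL reduction route (femto rung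
R2b1); `ValleyGeomAt` at `q > 4p`, `ValleyBOAt`, C3/C4 stay OPEN; not `¬TwistedTraceScaling`, not infinite volume, not a gap, not Clay.
Sorry-free, no new definition; axioms ⊆ {propext, Classical.choice, Quot.sound}.
-/

set_option autoImplicit false

noncomputable section

open Filter Topology
open scoped Matrix Quaternion BigOperators
open Literature.MathematicalPhysics.QuantumFieldTheory hiding SU2
open Literature.MathematicalPhysics.QuantumLattice
open Summit.QuantumFields.YangMills.Theorems.FemtoTransferGap
open Summit.QuantumFields.YangMills.Theorems.FemtoTransferGap.PhysL2 (twoLinkCfg)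
open Summit.QuantumFields.YangMills.Theorems.FemtoTransferGap.TwoLattice.Stiff (LinkSpace PlaqSpace)
open Summit.QuantumFields.YangMills.Theorems.FemtoTransferGap.TwoLattice.Cov (covCurl covCurl_apply ptrans1)
open Summit.QuantumFields.YangMills.Theorems.FemtoTransferGap.TwoLattice.Toron (abelianCfg diagSU2_add)
open Summit.QuantumFields.YangMills.Theorems.FemtoTransferGap.TwoLattice.Chart (frobNorm_sub_sq_eq)
open Summit.QuantumFields.YangMills.Theorems.TwistedTraceScaling.Negative.R8
open Summit.QuantumFields.YangMills.Theorems.TwistedTraceScaling.Negative.R9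
open Summit.QuantumFields.YangMills.Theorems.TwistedTraceScaling.Negative.R10

namespace Summit.QuantumFields.YangMills.Theorems.TwistedTraceScaling.Negative.R11

/-! ## §1 `adRot` closeness lifts to `SU(2)` closeness up to sign -/

section SignLift

/-- **The character identity behind the sign lift**: `Σ_{a,b} (adRot P − adRot Q)²_{ab} = 8(1 − ⟨p, q⟩²)`, `⟨p, q⟩` the Euclidean product of the unit
quaternions (i.e. `tr(Ad(P)ᵀAd(Q)) = 4⟨p,q⟩² − 1 = χ_{1/2}(P⁻¹Q)² − 1`). [cite: BrockerTomDieck1985, I (1.10)] -/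
theorem sum_adRot_sub_sq_eq (P Q : SU2) :
    ∑ a, ∑ b, (adRot P a b - adRot Q a b) ^ 2 =
      8 * (1 - (scalarPart P * scalarPart Q + (vecPart P 0 * vecPart Q 0 + vecPart P 1 * vecPart Q 1 + vecPart P 2 * vecPart Q 2)) ^ 2) := by
  have h1 := su2_sq_sum P
  have h2 := su2_sq_sum Q
  simp only [Fin.sum_univ_three, adRot, scalarPart_eq, vecPart_zero, vecPart_one, vecPart_two, Matrix.of_apply, Matrix.cons_val',
    Matrix.cons_val_zero, Matrix.cons_val_one, Matrix.cons_val_two, Matrix.head_cons, Matrix.tail_cons, Matrix.empty_val',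
    Matrix.cons_val_fin_one, Matrix.head_fin_const]
  linear_combination
    (3 * ((((P : Matrix (Fin 2) (Fin 2) ℂ) 0 0).re ^ 2 + ((P : Matrix (Fin 2) (Fin 2) ℂ) 0 0).im ^ 2 +
        ((P : Matrix (Fin 2) (Fin 2) ℂ) 0 1).re ^ 2 + ((P : Matrix (Fin 2) (Fin 2) ℂ) 0 1).im ^ 2) + 1) +
      2 * (((Q : Matrix (Fin 2) (Fin 2) ℂ) 0 0).re ^ 2 + ((Q : Matrix (Fin 2) (Fin 2) ℂ) 0 0).im ^ 2 +
        ((Q : Matrix (Fin 2) (Fin 2) ℂ) 0 1).re ^ 2 + ((Q : Matrix (Fin 2) (Fin 2) ℂ) 0 1).im ^ 2)) * h1 +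
    (3 * ((((Q : Matrix (Fin 2) (Fin 2) ℂ) 0 0).re ^ 2 + ((Q : Matrix (Fin 2) (Fin 2) ℂ) 0 0).im ^ 2 +
        ((Q : Matrix (Fin 2) (Fin 2) ℂ) 0 1).re ^ 2 + ((Q : Matrix (Fin 2) (Fin 2) ℂ) 0 1).im ^ 2) + 1) + 2) * h2

/-- **Sign lift**: if every entry of `adRot P − adRot Q` is at most `Δ` in absolute value, then `‖P − Q‖_F ≤ 3Δ` or `‖P − (−Q)‖_F ≤ 3Δ`
(`Ad : SU(2) → SO(3)` is two-to-one with kernel `{±1}`; quantitatively `min_± ‖P ∓ Q‖_F² ≤ ½ Σ(adRot P − adRot Q)²`). [cite: BrockerTomDieck1985, I (1.10)] -/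
theorem frobNorm_sub_le_or_of_adRot {P Q : SU2} {Δ : ℝ} (h : ∀ a b, |adRot P a b - adRot Q a b| ≤ Δ) :
    frobNorm ((P : Matrix (Fin 2) (Fin 2) ℂ) - (Q : Matrix (Fin 2) (Fin 2) ℂ)) ≤ 3 * Δ ∨
      frobNorm ((P : Matrix (Fin 2) (Fin 2) ℂ) - ((negOne * Q : SU2) : Matrix (Fin 2) (Fin 2) ℂ)) ≤ 3 * Δ := by
  have hΔ : 0 ≤ Δ := (abs_nonneg _).trans (h 0 0)
  have hsq : ∀ a b, (adRot P a b - adRot Q a b) ^ 2 ≤ Δ ^ 2 := fun a b => by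
    rw [← sq_abs]; exact pow_le_pow_left₀ (abs_nonneg _) (h a b) 2
  have hsum : ∑ a, ∑ b, (adRot P a b - adRot Q a b) ^ 2 ≤ 9 * Δ ^ 2 :=
    calc ∑ a, ∑ b, (adRot P a b - adRot Q a b) ^ 2 ≤ ∑ _a : Fin 3, ∑ _b : Fin 3, Δ ^ 2 :=
          Finset.sum_le_sum fun a _ => Finset.sum_le_sum fun b _ => hsq a b
      _ = 9 * Δ ^ 2 := by simp only [Finset.sum_const, Finset.card_univ, Fintype.card_fin]; ring
  rw [sum_adRot_sub_sq_eq] at hsum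
  set t : ℝ := scalarPart P * scalarPart Q + (vecPart P 0 * vecPart Q 0 + vecPart P 1 * vecPart Q 1 + vecPart P 2 * vecPart Q 2) with ht
  have h1 := su2_sq_sum P
  have h2 := su2_sq_sum Q
  have hPQ : frobNorm ((P : Matrix (Fin 2) (Fin 2) ℂ) - (Q : Matrix (Fin 2) (Fin 2) ℂ)) ^ 2 = 4 * (1 - t) := by
    rw [frobNorm_sub_sq_eq, ht]
    simp only [Fin.sum_univ_three, scalarPart_eq, vecPart_zero, vecPart_one, vecPart_two] at h1 h2 ⊢
    linear_combination 2 * h1 + 2 * h2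
  have hPQ' : frobNorm ((P : Matrix (Fin 2) (Fin 2) ℂ) - ((negOne * Q : SU2) : Matrix (Fin 2) (Fin 2) ℂ)) ^ 2 = 4 * (1 + t) := by
    rw [frobNorm_sub_sq_eq, scalarPart_negOne_mul, vecPart_negOne_mul, ht]
    simp only [Fin.sum_univ_three, Pi.neg_apply, scalarPart_eq, vecPart_zero, vecPart_one, vecPart_two] at h1 h2 ⊢
    linear_combination 2 * h1 + 2 * h2
  have key : ∀ {X : Matrix (Fin 2) (Fin 2) ℂ}, frobNorm X ^ 2 ≤ 9 * Δ ^ 2 → frobNorm X ≤ 3 * Δ := fun hX =>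
    (pow_le_pow_iff_left₀ (frobNorm_nonneg _) (by positivity) two_ne_zero).1 (by nlinarith [hX])
  rcases le_or_gt 0 t with ht0 | ht0
  · left
    apply key
    have h1t : 0 ≤ 1 - t := by nlinarith [frobNorm_nonneg ((P : Matrix (Fin 2) (Fin 2) ℂ) - (Q : Matrix (Fin 2) (Fin 2) ℂ)), hPQ]
    rw [hPQ]; nlinarith [mul_nonneg ht0 h1t, sq_nonneg Δ]
  · right
    apply key
    have h1t : 0 ≤ 1 + t := by
      nlinarith [frobNorm_nonneg ((P : Matrix (Fin 2) (Fin 2) ℂ) - ((negOne * Q : SU2) : Matrix (Fin 2) (Fin 2) ℂ)), hPQ']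
    rw [hPQ']; nlinarith [mul_nonneg (neg_nonneg.2 ht0.le) h1t, sq_nonneg Δ]

end SignLift

/-! ## §2 Single-link test vectors: GEOM closeness controls the transports `adRot(U_e)` entrywise -/

section TestVector

variable {L : ℕ}

/-- On a torus of side `L ≥ 2` a unit shift moves every site. [folklore] -/
theorem shift_ne_self (hL : 2 ≤ L) (x : Site 3 L) (i : Fin 3) : x.shift i ≠ x := by
  haveI : Fact (1 < L) := ⟨hL⟩
  intro h
  have h' := congr_fun h i
  simp [Site.shift] at h'

/-- **Single-link test vector**: for `v = e_{(x+î, j), b}` the plaquette-`(x,(i,j))` block of `D_U v` is the column `adRot(U(x,i))·e_b` (the other three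
terms of `covCurl_apply` vanish: the edges `(x,i)`, `(x+ĵ,i)` have direction `i ≠ j`, and `(x,j) ≠ (x+î,j)` once `x + î ≠ x`). [cite: Luscher1983, §3] -/
theorem covCurl_single (U : GaugeConfig 3 L SU2) (x : Site 3 L) (ij : {q : Fin 3 × Fin 3 // q.1 < q.2}) (a b : Fin 3)
    (hx : x.shift ij.1.1 ≠ x) :
    covCurl U (EuclideanSpace.single ((x.shift ij.1.1, ij.1.2), b) (1 : ℝ)) ((x, ij), a) = adRot (U (x, ij.1.1)) a b := by
  have hij : ij.1.1 ≠ ij.1.2 := ne_of_lt ij.2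
  rw [covCurl_apply]
  simp [ptrans1, hij, hx.symm]

/-- **GEOM closeness ⇒ entrywise closeness of the transports** on every FIRST edge `(x, i)` of a plaquette `(x, (i,j))`:
`|adRot(U(x,i))_{ab} − adRot(V(x,i))_{ab}| ≤ Δ` whenever `‖D_U v − D_V v‖ ≤ Δ‖v‖` for all `v` (and `x + î ≠ x`). [cite: Luscher1983, §3] -/
theorem abs_adRot_sub_le_of_covCurl [NeZero L] {U V : GaugeConfig 3 L SU2} {Δ : ℝ} (h : ∀ v : LinkSpace L, ‖covCurl U v - covCurl V v‖ ≤ Δ * ‖v‖)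
    (x : Site 3 L) (ij : {q : Fin 3 × Fin 3 // q.1 < q.2}) (hx : x.shift ij.1.1 ≠ x) (a b : Fin 3) :
    |adRot (U (x, ij.1.1)) a b - adRot (V (x, ij.1.1)) a b| ≤ Δ := by
  set w : LinkSpace L := EuclideanSpace.single ((x.shift ij.1.1, ij.1.2), b) (1 : ℝ) with hw
  have hw1 : ‖w‖ = 1 := by rw [hw, EuclideanSpace.single, PiLp.norm_single, norm_one]
  have hle := h w
  rw [hw1, mul_one] at hle
  have hcomp : |(covCurl U w - covCurl V w) ((x, ij), a)| ≤ ‖covCurl U w - covCurl V w‖ := by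
    have h' := PiLp.norm_apply_le (covCurl U w - covCurl V w) ((x, ij), a)
    rwa [Real.norm_eq_abs] at h'
  rw [PiLp.sub_apply, hw, covCurl_single U x ij a b hx, covCurl_single V x ij a b hx] at hcomp
  exact hcomp.trans hle

end TestVector

/-! ## §3 Signed telescoping of line holonomies and the commuting signed Polyakov loops of a gauge-toron -/

section Loops

variable {L : ℕ}

/-- **Signed telescoping**: if every direction-`k` link of `U` is within `r` of `±` the corresponding link of `V` (sign depending on the link), then every
direction-`k` line holonomy of `U` of length `n` is within `n·r` of `±` that of `V` (the signs are central and collect into `(−1)^m`). [folklore] -/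
theorem exists_sign_lineHolonomy_sub_le {U V : GaugeConfig 3 L SU2} {k : Fin 3} {r : ℝ}
    (h : ∀ y : Site 3 L, frobNorm (((U (y, k) : SU2) : Matrix (Fin 2) (Fin 2) ℂ) - ((V (y, k) : SU2) : Matrix (Fin 2) (Fin 2) ℂ)) ≤ r ∨
      frobNorm (((U (y, k) : SU2) : Matrix (Fin 2) (Fin 2) ℂ) - ((negOne * V (y, k) : SU2) : Matrix (Fin 2) (Fin 2) ℂ)) ≤ r) :
    ∀ (n : ℕ) (y : Site 3 L), ∃ m : ℕ, frobNorm (((lineHolonomy U k n y : SU2) : Matrix (Fin 2) (Fin 2) ℂ) -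
      ((negOne ^ m * lineHolonomy V k n y : SU2) : Matrix (Fin 2) (Fin 2) ℂ)) ≤ n * r
  | 0, y => ⟨0, by simp [lineHolonomy, frobNorm_zero]⟩
  | n + 1, y => by
    obtain ⟨m, hm⟩ := exists_sign_lineHolonomy_sub_le h n (y.shift k)
    have hr : 0 ≤ r := by
      rcases h y with h0 | h0 <;> exact (frobNorm_nonneg _).trans h0
    have hc : ∀ u : SU2, u * negOne ^ m = negOne ^ m * u := fun u =>
      Subgroup.mem_center_iff.1 (Subgroup.pow_mem _ negOne_mem_center m) u
    rcases h y with h0 | h0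
    · refine ⟨m, ?_⟩
      have hrw : negOne ^ m * lineHolonomy V k (n + 1) y = V (y, k) * (negOne ^ m * lineHolonomy V k n (y.shift k)) := by
        rw [lineHolonomy, ← mul_assoc, ← hc, mul_assoc]
      rw [hrw, lineHolonomy, Submonoid.coe_mul, Submonoid.coe_mul, Nat.cast_succ]
      refine (frobNorm_mul_sub_mul_le (su2_mem_unitaryGroup _) (su2_mem_unitaryGroup _)).trans ?_
      linarith
    · refine ⟨m + 1, ?_⟩
      have hrw : negOne ^ (m + 1) * lineHolonomy V k (n + 1) y = (negOne * V (y, k)) * (negOne ^ m * lineHolonomy V k n (y.shift k)) := by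
        rw [lineHolonomy, pow_succ, ← mul_assoc (negOne * V (y, k)) (negOne ^ m), hc (negOne * V (y, k))]
        simp only [mul_assoc]
      rw [hrw, lineHolonomy, Submonoid.coe_mul, Submonoid.coe_mul, Nat.cast_succ]
      refine (frobNorm_mul_sub_mul_le (su2_mem_unitaryGroup _) (su2_mem_unitaryGroup _)).trans ?_
      linarith

/-- Full-period line holonomies of the constant abelian configuration. [folklore] -/
theorem lineHolonomy_abelianCfg (θ : Fin 3 → ℝ) (k : Fin 3) (n : ℕ) (y : Site 3 L) :
    lineHolonomy (abelianCfg L θ) k n y = diagSU2 (θ k) ^ n :=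
  lineHolonomy_const (fun k => diagSU2 (θ k)) k n y

/-- Diagonal elements commute. [folklore] -/
theorem commute_diagSU2 (a b : ℝ) : Commute (diagSU2 a) (diagSU2 b) := by
  show diagSU2 a * diagSU2 b = diagSU2 b * diagSU2 a
  rw [← diagSU2_add, ← diagSU2_add, add_comm]

/-- **The obstruction near a gauge-toron.**  If every direction-0/1 link of the two-link witness `twoLinkCfg a_α b_τ` is within `r` of `±` the corresponding
link of `g·V_θ`, then `min(sin Lα, sin Lτ) ≤ 2Lr`: the signed Polyakov loops `±g(0)·diag(θ_k)^L·g(0)⁻¹` of the gauge-toron COMMUTE and are within `Lr`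
of `a^L`, `b^L` (rotations by `Lα`, `Lτ` about orthogonal axes), and R10's `min_le_of_commute_near_axes` applies. [cite: Luscher1983, §2] -/
theorem min_sin_le_of_near_toron [NeZero L] {a b : SU2} {α τ : ℝ} (ha : su2Quat a = ⟨Real.cos α, Real.sin α, 0, 0⟩)
    (hb : su2Quat b = ⟨Real.cos τ, 0, Real.sin τ, 0⟩) (g : Site 3 L → SU2) (θ : Fin 3 → ℝ) {r : ℝ}
    (h : ∀ (y : Site 3 L) (k : Fin 3), k ≠ 2 →
      frobNorm (((twoLinkCfg (L := L) a b (y, k) : SU2) : Matrix (Fin 2) (Fin 2) ℂ) -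
          ((gaugeTransform g (abelianCfg L θ) (y, k) : SU2) : Matrix (Fin 2) (Fin 2) ℂ)) ≤ r ∨
        frobNorm (((twoLinkCfg (L := L) a b (y, k) : SU2) : Matrix (Fin 2) (Fin 2) ℂ) -
          ((negOne * gaugeTransform g (abelianCfg L θ) (y, k) : SU2) : Matrix (Fin 2) (Fin 2) ℂ)) ≤ r) :
    min (Real.sin (L * α)) (Real.sin (L * τ)) ≤ 2 * (L * r) := by
  obtain ⟨m₀, h₀⟩ := exists_sign_lineHolonomy_sub_le (U := twoLinkCfg (L := L) a b) (V := gaugeTransform g (abelianCfg L θ)) (k := 0)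
    (fun y => h y 0 (by decide)) L 0
  obtain ⟨m₁, h₁⟩ := exists_sign_lineHolonomy_sub_le (U := twoLinkCfg (L := L) a b) (V := gaugeTransform g (abelianCfg L θ)) (k := 1)
    (fun y => h y 1 (by decide)) L 0
  rw [lineHolonomy_twoLinkCfg_zero, lineHolonomy_gaugeTransform_period, lineHolonomy_abelianCfg] at h₀
  rw [lineHolonomy_twoLinkCfg_one, lineHolonomy_gaugeTransform_period, lineHolonomy_abelianCfg] at h₁
  -- the two signed loops commute
  have hz : ∀ (m : ℕ) (u : SU2), Commute (negOne ^ m) u := fun m u =>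
    (Subgroup.mem_center_iff.1 (Subgroup.pow_mem _ negOne_mem_center m) u).symm
  have hPQ : Commute (g 0 * diagSU2 (θ 0) ^ L * (g 0)⁻¹) (g 0 * diagSU2 (θ 1) ^ L * (g 0)⁻¹) := by
    have hc := ((commute_diagSU2 (θ 0) (θ 1)).pow_pow L L).map (MulAut.conj (g 0))
    simpa only [MulAut.conj_apply, map_mul, map_inv] using hc
  have hXY : Commute (negOne ^ m₀ * (g 0 * diagSU2 (θ 0) ^ L * (g 0)⁻¹)) (negOne ^ m₁ * (g 0 * diagSU2 (θ 1) ^ L * (g 0)⁻¹)) :=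
    Commute.mul_left (hz m₀ _) (Commute.mul_right (hz m₁ _).symm hPQ)
  exact min_le_of_commute_near_axes hXY.eq (su2Quat_pow_axisI ha L) (su2Quat_pow_axisJ hb L) h₀ h₁

end Loops

/-! ## §4 ★ The refutation of `ValleyGeomAt` below the line `q = 4p` -/

section Main

set_option maxHeartbeats 400000 in
/-- ★ **R11. `ValleyGeomAt L δ η` is false whenever `δ⁴ ≲ η` frequently** (`L ≥ 2`).  For scale functions `δ, η → 0` and `M > 0` with `0 < δ β` and
`δ β⁴ ≤ M·η β` for arbitrarily large `β`, the GEOM sub-target fails: at such `β` the witness `twoLinkCfg a_{θ/L} b_{Ls/θ}` (`s = √(η/(4#P+1))`,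
`θ = max(2Lδ, L√s)`) lies in `valleySet L (δ β) (η β)`, while every gauge-toron `g·V_θ'` with `‖D_U v − D_{g·V_θ'} v‖ ≤ εδ‖v‖` would force
`sin(L²s/θ) ≤ 6Lεδ`, against `L²s/θ ≥ Lδ/(3√(M(4#P+1)) + 1)` — impossible at `ε = 1/(20(3√(M(4#P+1)) + 1))`. [cite: Luscher1983, §2–§3] -/
theorem valleyGeom_false (L : ℕ) [NeZero L] (hL : 2 ≤ L) {δ η : ℝ → ℝ} (hδ : Tendsto δ atTop (𝓝 0)) (hη : Tendsto η atTop (𝓝 0))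
    {M : ℝ} (hM : 0 < M) (hdom : ∃ᶠ β in atTop, 0 < δ β ∧ δ β ^ 4 ≤ M * η β) : ¬ ValleyGeomAt L δ η := by
  rintro ⟨c₀, -, H⟩
  have hLnat : 0 < L := Nat.pos_of_ne_zero (NeZero.ne L)
  have hLpos : (0 : ℝ) < L := Nat.cast_pos.2 hLnat
  have hLne : (L : ℝ) ≠ 0 := hLpos.ne'
  have hL1 : (1 : ℝ) ≤ L := by exact_mod_cast hLnat
  have hπ := Real.pi_pos
  set K : ℝ := 4 * (Fintype.card (Plaquette 3 L) : ℝ) with hK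
  have hK0 : 0 ≤ K := by positivity
  have hK1 : 0 < K + 1 := by positivity
  set N : ℝ := Real.sqrt (M * (K + 1)) with hN
  have hN0 : 0 < N := Real.sqrt_pos.2 (by positivity)
  set c₁ : ℝ := 1 / (3 * N + 1) with hc₁
  have hc₁0 : 0 < c₁ := by positivity
  set ε : ℝ := c₁ / 20 with hε
  have hε0 : 0 < ε := by positivity
  obtain ⟨β₀, Hβ⟩ := H ε hε0
  -- the auxiliary scale `θ(β) = max(2Lδ, L√s)` tends to zero; pick a good `β`
  have hs_t : Tendsto (fun β => Real.sqrt (η β / (K + 1))) atTop (𝓝 0) := by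
    have h := (hη.div_const (K + 1)).sqrt
    rwa [zero_div, Real.sqrt_zero] at h
  have hθ_t : Tendsto (fun β => max (2 * L * δ β) (L * Real.sqrt (Real.sqrt (η β / (K + 1))))) atTop (𝓝 0) := by
    have h := (hδ.const_mul (2 * (L : ℝ))).max (hs_t.sqrt.const_mul (L : ℝ))
    rwa [Real.sqrt_zero, mul_zero, mul_zero, max_self] at h
  have hθ_e : ∀ᶠ β in atTop, max (2 * L * δ β) (L * Real.sqrt (Real.sqrt (η β / (K + 1)))) < 1 := hθ_t.eventually_lt_const one_pos
  obtain ⟨β, ⟨hδβ, hdomβ⟩, hβ₀, hθβ⟩ := (hdom.and_eventually ((eventually_ge_atTop β₀).and hθ_e)).exists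
  have hηβ : 0 < η β := pos_of_mul_pos_right ((by positivity : 0 < δ β ^ 4).trans_le hdomβ) hM.le
  -- the parameters at this `β`
  set s : ℝ := Real.sqrt (η β / (K + 1)) with hs
  set θ : ℝ := max (2 * L * δ β) (L * Real.sqrt s) with hθ
  have hs0 : 0 < s := Real.sqrt_pos.2 (div_pos hηβ hK1)
  have hss : s ^ 2 = η β / (K + 1) := Real.sq_sqrt (div_pos hηβ hK1).le
  have hθ0 : 0 < θ := lt_max_of_lt_right (by positivity)
  have hθ1 : θ ≤ 1 := hθβ.le
  have hθδ : 2 * L * δ β ≤ θ := le_max_left _ _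
  have hθs : L * Real.sqrt s ≤ θ := le_max_right _ _
  have hθs2 : (L : ℝ) ^ 2 * s ≤ θ ^ 2 := by
    have h := pow_le_pow_left₀ (by positivity : (0 : ℝ) ≤ L * Real.sqrt s) hθs 2
    rwa [mul_pow, Real.sq_sqrt hs0.le] at h
  have hθle : θ ≤ 2 * L * δ β + L * Real.sqrt s :=
    max_le (by linarith only [mul_nonneg hLpos.le (Real.sqrt_nonneg s)]) (by linarith only [mul_pos hLpos hδβ])
  have hθπ : θ ≤ Real.pi / 2 := by linarith only [hθ1, Real.pi_gt_three]
  set α : ℝ := θ / L with hα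
  set τ : ℝ := L * s / θ with hτ
  have hα0 : 0 < α := by positivity
  have hLα : (L : ℝ) * α = θ := by rw [hα, mul_div_assoc', mul_div_cancel_left₀ θ hLne]
  have hτ0 : 0 < τ := by positivity
  have hθne : θ ≠ 0 := hθ0.ne'
  have hLτθ : (L : ℝ) * τ * θ = L ^ 2 * s := by rw [hτ, mul_div_assoc', div_mul_cancel₀ _ hθne]; ring
  have hLτ : (L : ℝ) * τ ≤ θ := by
    have h : (L : ℝ) * τ * θ ≤ θ * θ := by rw [hLτθ, ← sq]; exact hθs2
    exact le_of_mul_le_mul_right h hθ0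
  have hατ : α * τ = s := by
    rw [hα, hτ, div_mul_div_comm, show θ * (L * s) = s * (L * θ) by ring, mul_div_assoc, div_self (mul_pos hLpos hθ0).ne', mul_one]
  have hδα : δ β < α := by
    have h2 : 2 * δ β ≤ α := by rw [hα, le_div_iff₀ hLpos]; linarith only [hθδ]
    linarith only [h2, hδβ]
  -- the action budget
  have hSlt : 4 * (Fintype.card (Plaquette 3 L) : ℝ) * (Real.sin α ^ 2 * Real.sin τ ^ 2) < 2 * η β := by
    have hαπ : α ≤ Real.pi := by
      have : α ≤ L * α := le_mul_of_one_le_left hα0.le hL1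
      linarith only [this, hLα, hθ1, Real.pi_gt_three]
    have hτπ : τ ≤ Real.pi := by
      have : τ ≤ L * τ := le_mul_of_one_le_left hτ0.le hL1
      linarith only [this, hLτ, hθ1, Real.pi_gt_three]
    have h1 : Real.sin α ^ 2 ≤ α ^ 2 := pow_le_pow_left₀ (Real.sin_nonneg_of_nonneg_of_le_pi hα0.le hαπ) (Real.sin_le hα0.le) 2
    have h2 : Real.sin τ ^ 2 ≤ τ ^ 2 := pow_le_pow_left₀ (Real.sin_nonneg_of_nonneg_of_le_pi hτ0.le hτπ) (Real.sin_le hτ0.le) 2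
    have h3 : Real.sin α ^ 2 * Real.sin τ ^ 2 ≤ s ^ 2 := by
      rw [← hατ, mul_pow]; exact mul_le_mul h1 h2 (sq_nonneg _) (sq_nonneg _)
    have h4 : K * s ^ 2 ≤ η β := by
      rw [hss, mul_div_assoc', div_le_iff₀ hK1]; linarith only [hηβ]
    calc 4 * (Fintype.card (Plaquette 3 L) : ℝ) * (Real.sin α ^ 2 * Real.sin τ ^ 2) ≤ K * s ^ 2 := mul_le_mul_of_nonneg_left h3 hK0
      _ ≤ η β := h4
      _ < 2 * η β := by linarith only [hηβ]
  -- the witness, its valley membership, and the gauge-toron supplied by GEOM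
  obtain ⟨a, ha⟩ := exists_su2Quat_eq _ (normSq_axisI α)
  obtain ⟨b, hb⟩ := exists_su2Quat_eq _ (normSq_axisJ τ)
  have hmem : twoLinkCfg (L := L) a b ∈ valleySet L (δ β) (η β) :=
    twoLinkCfg_mem_valleySet ha hb hα0 (by rw [hLα]; exact hθπ) hδα hSlt
  obtain ⟨g, θ', -, hclose, -⟩ := Hβ β hβ₀ _ hmem
  -- entrywise transport closeness on direction-0/1 links, lifted to SU(2) up to sign
  have hlink : ∀ (y : Site 3 L) (k : Fin 3), k ≠ 2 →
      frobNorm (((twoLinkCfg (L := L) a b (y, k) : SU2) : Matrix (Fin 2) (Fin 2) ℂ) -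
          ((gaugeTransform g (abelianCfg L θ') (y, k) : SU2) : Matrix (Fin 2) (Fin 2) ℂ)) ≤ 3 * (ε * δ β) ∨
        frobNorm (((twoLinkCfg (L := L) a b (y, k) : SU2) : Matrix (Fin 2) (Fin 2) ℂ) -
          ((negOne * gaugeTransform g (abelianCfg L θ') (y, k) : SU2) : Matrix (Fin 2) (Fin 2) ℂ)) ≤ 3 * (ε * δ β) := by
    intro y k hk
    have hk' : k = 0 ∨ k = 1 := by
      rcases Fin.eq_zero_or_eq_succ k with h | ⟨j, rfl⟩
      · exact Or.inl h
      · rcases Fin.eq_zero_or_eq_succ j with h | ⟨i, rfl⟩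
        · right; rw [h]; rfl
        · exact absurd (by rw [Fin.eq_zero i]; rfl) hk
    rcases hk' with rfl | rfl
    · exact frobNorm_sub_le_or_of_adRot fun c d =>
        abs_adRot_sub_le_of_covCurl hclose y ⟨(0, 1), by decide⟩ (shift_ne_self hL y 0) c d
    · exact frobNorm_sub_le_or_of_adRot fun c d =>
        abs_adRot_sub_le_of_covCurl hclose y ⟨(1, 2), by decide⟩ (shift_ne_self hL y 1) c d
  have hkey := min_sin_le_of_near_toron ha hb g θ' hlink
  -- endgame: `sin(Lτ) ≤ 6Lεδ` against `Lτ ≥ c₁Lδ` and Jordan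
  have hLτ0 : 0 < (L : ℝ) * τ := by positivity
  have hle : Real.sin (L * τ) ≤ Real.sin (L * α) := by
    rw [hLα]; exact Real.sin_le_sin_of_le_of_le_pi_div_two (by linarith only [hLτ0, hπ]) hθπ hLτ
  rw [min_eq_right hle] at hkey
  have hjordan : 2 / Real.pi * (L * τ) ≤ Real.sin (L * τ) := Real.mul_le_sin hLτ0.le (hLτ.trans hθπ)
  -- `δ² ≤ N s` and `δ√s ≤ (N+1)s`, hence `c₁ δ θ ≤ L s`, i.e. `c₁ δ ≤ τ`
  have hsη : Real.sqrt (η β) = Real.sqrt (K + 1) * s := by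
    rw [hs, ← Real.sqrt_mul hK1.le, mul_div_assoc', mul_div_cancel_left₀ _ hK1.ne']
  have hδ2 : δ β ^ 2 ≤ N * s := by
    have h1 : δ β ^ 2 = Real.sqrt (δ β ^ 4) := by
      rw [show δ β ^ 4 = (δ β ^ 2) ^ 2 by ring, Real.sqrt_sq (sq_nonneg _)]
    have h2 : Real.sqrt (M * η β) = N * s := by
      rw [Real.sqrt_mul hM.le, hsη, hN, Real.sqrt_mul hM.le]; ring
    rw [h1, ← h2]
    exact Real.sqrt_le_sqrt hdomβ
  have hδs : δ β * Real.sqrt s ≤ (N + 1) * s := by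
    have h2 : δ β * Real.sqrt s ≤ (δ β ^ 2 + Real.sqrt s ^ 2) / 2 := by nlinarith only [sq_nonneg (δ β - Real.sqrt s)]
    rw [Real.sq_sqrt hs0.le] at h2
    linarith only [h2, hδ2, mul_nonneg hN0.le hs0.le, hs0]
  have hτc : c₁ * δ β ≤ τ := by
    rw [hτ, le_div_iff₀ hθ0]
    have h3 : c₁ * δ β * θ ≤ c₁ * δ β * (2 * L * δ β + L * Real.sqrt s) := mul_le_mul_of_nonneg_left hθle (by positivity)
    have h4 : 2 * δ β ^ 2 + δ β * Real.sqrt s ≤ (3 * N + 1) * s := by linarith only [hδ2, hδs]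
    have h5 : c₁ * (3 * N + 1) = 1 := by rw [hc₁]; exact one_div_mul_cancel (by positivity)
    calc c₁ * δ β * θ ≤ c₁ * δ β * (2 * L * δ β + L * Real.sqrt s) := h3
      _ = c₁ * L * (2 * δ β ^ 2 + δ β * Real.sqrt s) := by ring
      _ ≤ c₁ * L * ((3 * N + 1) * s) := mul_le_mul_of_nonneg_left h4 (by positivity)
      _ = c₁ * (3 * N + 1) * (L * s) := by ring
      _ = L * s := by rw [h5, one_mul]
  -- contradiction
  have h1 : (L : ℝ) * τ / 2 ≤ Real.sin (L * τ) := by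
    have hπ4 := Real.pi_le_four
    have : (L : ℝ) * τ / 2 ≤ 2 / Real.pi * (L * τ) := by
      rw [div_mul_eq_mul_div, le_div_iff₀ hπ]; nlinarith only [hLτ0, hπ4]
    exact this.trans hjordan
  have h2 : Real.sin (L * τ) ≤ 2 * (L * (3 * (ε * δ β))) := hkey
  have h3 : c₁ * δ β * L / 2 ≤ 2 * (L * (3 * (ε * δ β))) := by
    have := mul_le_mul_of_nonneg_left hτc hLpos.le
    linarith only [h1, h2, this]
  rw [hε] at h3
  linarith only [h3, mul_pos (mul_pos hc₁0 hδβ) hLpos]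

/-- ★ **R11 at lane A's scales: the exponent line `q > 4p` of the C3 skeleton is necessary.**  For `0 < p` and `0 < q ≤ 4p` (and `L ≥ 2`) the typed sub-target
`ValleyGeomAt L (powScale p) (powScale q)` of `coarseNoIntruderAt_of_bo_geom_pow` is FALSE (`δ⁴ = β^{−4p} ≤ β^{−q} = η`). [cite: Luscher1983, §2–§3] -/
theorem valleyGeom_pow_false (L : ℕ) [NeZero L] (hL : 2 ≤ L) {p q : ℝ} (hp : 0 < p) (hq : 0 < q) (hqp : q ≤ 4 * p) :
    ¬ ValleyGeomAt L (powScale p) (powScale q) := by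
  refine valleyGeom_false L hL (tendsto_powScale hp) (tendsto_powScale hq) one_pos (Eventually.frequently (Eventually.of_forall fun β => ?_))
  refine ⟨powScale_pos p β, ?_⟩
  have hb : 1 ≤ max β 1 := le_max_right _ _
  have hb0 : 0 ≤ max β 1 := zero_le_one.trans hb
  rw [one_mul, powScale, powScale, ← Real.rpow_natCast, ← Real.rpow_mul hb0]
  exact Real.rpow_le_rpow_of_exponent_le hb (by push_cast; linarith)

end Main

end Summit.QuantumFields.YangMills.Theorems.TwistedTraceScaling.Negative.R11

end
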